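import Literature.Geometry.DiscreteGeometry.DelsarteLinearProgrammingBound

/-!
# The degree-three linear programming bound (Levenshtein's `L₃` in closed form, all `n ≥ 3`)

Framing: lottery ticket; floor = certified bounds/negative ranges. Venture `PackingBounds`
(cell `pub-packcert`), spherical-code family; closed-form bound symbolic in `(n, s, a)`.

**Theorem.** Let `n ≥ 3`, `s ≤ 1`, and let `a` be a real parameter with `s ≤ 2a`,
`3/(n+2) + a² - 2as ≥ 0` and `(2a - s)/n - a² s ≥ 0`. Every finite set `C` of unit vectors of `ℝⁿ`
with pairwise inner products `≤ s` satisfies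
`|C| · ((2a - s)/n - a² s) ≤ (1 - s)(1 + a)²`.
Proof: the cubic Delsarte certificate `f(t) = (t - s)(t + a)²` is `≤ 0` on `[-1, s]` for ANY `a`, and
its Gegenbauer coefficients (`μ = (n-2)/2`; `C_1 = 2μt`, `C_2 = 2μ(μ+1)t² - μ`,
`C_3 = (4/3)μ(μ+1)(μ+2)t³ - 2μ(μ+1)t`) are
`f_0 = (2a-s)/n - a²s`, `f_1 = (a² - 2as)/(2μ) + 3/(4μ(μ+2))`, `f_2 = (2a-s)/(2μ(μ+1))`,
`f_3 = 3/(4μ(μ+1)(μ+2))` — nonnegative exactly under the stated side conditions; then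
`Literature.Geometry.DiscreteGeometry.DelsarteLP.card_mul_le`. With Levenshtein's optimal
`a = (1+s)/(1+ns)` this is the bound `L₃(n,s) = n(1-s)(2+(n+1)s)/(1-ns²)`; it is SHARP e.g. for the
16-point code in `ℝ⁵` (`s = 1/5, a = 3/5`), the 27-point code in `ℝ⁶` (`s = 1/4, a = 1/2`), the
Higman–Sims (`ℝ²²`, `s = 1/11, a = 4/11`) and McLaughlin (`ℝ²²`, `s = 1/6, a = 1/4`) codes.

## References
* P. Delsarte, J. M. Goethals, J. J. Seidel, Geom. Dedicata 6 (1977) 363–388, §4. [`DelsarteGoethalsSeidel1977`]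
* V. I. Levenshtein, Soviet Math. Dokl. 20 (1979) 417–421. [`Levenshtein1979`]
-/

namespace Summit.Ventures.PackingBounds.SphericalCodes

open Finset Literature.Analysis.SpecialFunctions Literature.Geometry.DiscreteGeometry

/-- Degree-three LP bound with the Gegenbauer parameter `μ` explicit (`n = 2μ + 2`, `μ > 0`):
`|C| · ((2a-s)/(2μ+2) - a²s) ≤ (1-s)(1+a)²` for codes with inner products `≤ s`, under the exact
nonnegativity conditions of the certificate `(t-s)(t+a)²`.
[cite: DelsarteGoethalsSeidel1977, §4 (linear programming bound, cubic example)] -/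
theorem degree_three_card_mul_le_aux {n : ℕ} {μ : ℝ} (hnμ : (n : ℝ) = 2 * μ + 2) (hμ : 0 < μ)
    (s a : ℝ) (has : s ≤ 2 * a) (hf1 : 0 ≤ 3 / (2 * (μ + 2)) + a ^ 2 - 2 * a * s)
    (hf0 : 0 ≤ (2 * a - s) / (2 * μ + 2) - a ^ 2 * s)
    (C : Finset (EuclideanSpace ℝ (Fin n)))
    (h1 : ∀ x ∈ C, ‖x‖ = 1) (h2 : ∀ x ∈ C, ∀ y ∈ C, x ≠ y → inner ℝ x y ≤ s) :
    (C.card : ℝ) * ((2 * a - s) / (2 * μ + 2) - a ^ 2 * s) ≤ (1 - s) * (1 + a) ^ 2 := by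
  have hμ1 : (0 : ℝ) < μ + 1 := by linarith
  have hμ2 : (0 : ℝ) < μ + 2 := by linarith
  have hμne : μ ≠ 0 := hμ.ne'
  have hμ1ne : μ + 1 ≠ 0 := hμ1.ne'
  have hμ2ne : μ + 2 ≠ 0 := hμ2.ne'
  have h2μ2 : (2 : ℝ) * μ + 2 ≠ 0 := by positivity
  have hC2 : ∀ t : ℝ, gegenbauerSum μ 2 t = 2 * μ * (μ + 1) * t ^ 2 - μ := by
    intro t
    simp [gegenbauerSum, gegenbauerCoeff, Finset.sum_range_succ, Finset.prod_range_succ,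
      Nat.factorial]
    ring
  have hC3 : ∀ t : ℝ, gegenbauerSum μ 3 t =
      4 / 3 * μ * (μ + 1) * (μ + 2) * t ^ 3 - 2 * μ * (μ + 1) * t := by
    intro t
    simp [gegenbauerSum, gegenbauerCoeff, Finset.sum_range_succ, Finset.prod_range_succ,
      Nat.factorial]
    ring
  have hpoly : ∀ t : ℝ, ∑ k ∈ range (3 + 1),
      (fun k => match k with
        | 0 => (2 * a - s) / (2 * μ + 2) - a ^ 2 * s
        | 1 => (a ^ 2 - 2 * a * s) / (2 * μ) + 3 / (4 * μ * (μ + 2))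
        | 2 => (2 * a - s) / (2 * μ * (μ + 1))
        | 3 => 3 / (4 * μ * (μ + 1) * (μ + 2))
        | _ => 0) k * gegenbauerSum μ k t = (t - s) * (t + a) ^ 2 := by
    intro t
    simp only [Finset.sum_range_succ, Finset.sum_range_zero, zero_add, gegenbauerSum_zero,
      gegenbauerSum_one, hC2, hC3]
    field_simp
    ring
  have key := DelsarteLP.card_mul_le (n := n) (μ := μ) hnμ hμ 3
    (fun k => match k with
      | 0 => (2 * a - s) / (2 * μ + 2) - a ^ 2 * s
      | 1 => (a ^ 2 - 2 * a * s) / (2 * μ) + 3 / (4 * μ * (μ + 2))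
      | 2 => (2 * a - s) / (2 * μ * (μ + 1))
      | 3 => 3 / (4 * μ * (μ + 1) * (μ + 2))
      | _ => 0)
    ?_ s ?_ C h1 h2
  · rw [hpoly] at key
    have key' : (C.card : ℝ) * ((2 * a - s) / (2 * μ + 2) - a ^ 2 * s) ≤ (1 - s) * (1 + a) ^ 2 := key
    exact key'
  · intro k
    split
    · exact hf0
    · -- f_1 = (2(μ+2)(a²-2as) + 3) / (4μ(μ+2)) ≥ 0
      have : (a ^ 2 - 2 * a * s) / (2 * μ) + 3 / (4 * μ * (μ + 2)) =
          (3 / (2 * (μ + 2)) + a ^ 2 - 2 * a * s) / (2 * μ) := by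
        field_simp
        ring
      rw [this]
      positivity
    · have : 0 ≤ 2 * a - s := by linarith
      positivity
    · positivity
    · exact le_refl 0
  · intro t ht1 ht2
    rw [hpoly]
    exact mul_nonpos_of_nonpos_of_nonneg (by linarith) (sq_nonneg _)

/-- **Degree-three LP bound** (`n ≥ 3`): for a parameter `a` with `s ≤ 2a`,
`3/(n+2) + a² - 2as ≥ 0` and `(2a-s)/n - a²s ≥ 0`, every finite set `C` of unit vectors of `ℝⁿ`
with pairwise inner products `≤ s` satisfies `|C| · ((2a-s)/n - a²s) ≤ (1-s)(1+a)²`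
(certificate `(t-s)(t+a)²`; Levenshtein's `L₃(n,s)` at `a = (1+s)/(1+ns)`).
[cite: DelsarteGoethalsSeidel1977, §4 (linear programming bound, cubic example)] -/
theorem degree_three_card_mul_le (n : ℕ) (hn : 3 ≤ n) (s a : ℝ) (has : s ≤ 2 * a)
    (hf1 : 0 ≤ 3 / ((n : ℝ) + 2) + a ^ 2 - 2 * a * s) (hf0 : 0 ≤ (2 * a - s) / (n : ℝ) - a ^ 2 * s)
    (C : Finset (EuclideanSpace ℝ (Fin n)))
    (h1 : ∀ x ∈ C, ‖x‖ = 1) (h2 : ∀ x ∈ C, ∀ y ∈ C, x ≠ y → inner ℝ x y ≤ s) :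
    (C.card : ℝ) * ((2 * a - s) / (n : ℝ) - a ^ 2 * s) ≤ (1 - s) * (1 + a) ^ 2 := by
  have hn' : (3 : ℝ) ≤ n := by exact_mod_cast hn
  obtain ⟨μ, hnμ⟩ : ∃ μ : ℝ, (n : ℝ) = 2 * μ + 2 := ⟨((n : ℝ) - 2) / 2, by ring⟩
  have hμ : (0 : ℝ) < μ := by linarith
  have hf1' : 0 ≤ 3 / (2 * (μ + 2)) + a ^ 2 - 2 * a * s := by
    have : (2 : ℝ) * (μ + 2) = (n : ℝ) + 2 := by rw [hnμ]; ring
    rw [this]; exact hf1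
  have hf0' : 0 ≤ (2 * a - s) / (2 * μ + 2) - a ^ 2 * s := by rw [← hnμ]; exact hf0
  have key := degree_three_card_mul_le_aux hnμ hμ s a has hf1' hf0' C h1 h2
  rw [← hnμ] at key
  exact key

/-- Example (sharpness check of the closed form): the 16-point code in `ℝ⁵` — `n = 5`, `s = 1/5`,
`a = 3/5` gives `|C| · 16/125 ≤ 256/125`, i.e. `|C| ≤ 16` (cf. `code_dim5_le_16`). [folklore] -/
example (C : Finset (EuclideanSpace ℝ (Fin 5))) (h1 : ∀ x ∈ C, ‖x‖ = 1)
    (h2 : ∀ x ∈ C, ∀ y ∈ C, x ≠ y → inner ℝ x y ≤ 1 / 5) : (C.card : ℝ) ≤ 16 := by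
  have h := degree_three_card_mul_le 5 (by norm_num) (1 / 5) (3 / 5) (by norm_num) (by norm_num)
    (by norm_num) C h1 h2
  norm_num at h
  linarith

end Summit.Ventures.PackingBounds.SphericalCodes
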